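import Summits.QuantumAdvantage.QuantumAdvantage.Theorems.FanInRootDefs

/-!
# FanInRoot (10/11): TIGHTNESS of the half-degree threshold — explicit PERFECT degree-`r` strategies on the bare `C_{2r+2}`, `r = 1, 2, 3` (`decide`)
-/

set_option linter.dupNamespace false -- D-0017: single-problem summit ⇒ `QuantumAdvantage.QuantumAdvantage` by design

namespace Summit.QuantumAdvantage.QuantumAdvantage.Theorems.FanInRoot

open Finset
open Summit.QuantumAdvantage.AdviceFreeQNC0
open Literature.Computability.QuantumComplexity
open Literature.Computability.QuantumComplexity.RingHLF
open Literature.Computability.MetaComplexity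
open scoped Classical

/-! ### §6l TIGHTNESS of the half-degree threshold: PERFECT low-degree strategies on the bare cycles `C_{2r+2}`, `r = 1, 2, 3`

`HalfDegreeLaw2` asks `2r + 3 ≤ k`.  The bound cannot be lowered to `2r + 2` for `r ≤ 3`: explicit perfect strategies of `𝔽₂`-degree `r` on `C_4`, `C_6`, `C_8` (found by GF(2) elimination,
`exp/solve_perfect.py`; remarkably each uses only TWO non-zero outputs), kernel-checked here.  A strategy is given by monomial families `F j` (the ANF of output `j`);
`w β j = ⊕_{S ∈ F j} [S ⊆ supp β]`. -/
namespace Tight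

/-- The strategy with ANF families `F`. -/
def strat {k : ℕ} (F : Fin k → Finset (Finset (Fin k))) (β : Fin k → Bool) (j : Fin k) : Bool :=
  decide (((F j).filter fun S => ∀ a ∈ S, β a = true).card % 2 = 1)

/-- ANF ⟹ degree: if every monomial of `F j` has size `≤ r` then the indicator of output `j` lies in `lowDeg r`. -/
theorem strat_mem_lowDeg {k r : ℕ} (F : Fin k → Finset (Finset (Fin k))) (hF : ∀ j, ∀ S ∈ F j, S.card ≤ r)
    (hind : ∀ j : Fin k, ∀ β : Fin k → Bool, (if strat F β j = true then (1 : ZMod 2) else 0) = ∑ S ∈ F j, (if (∀ i ∈ S, β i = true) then (1 : ZMod 2) else 0))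
    (j : Fin k) : (fun β : Fin k → Bool => if strat F β j = true then (1 : ZMod 2) else 0) ∈ Smolensky.lowDeg (ZMod 2) k r := by
  have : (fun β : Fin k → Bool => if strat F β j = true then (1 : ZMod 2) else 0) = ∑ S ∈ F j, Smolensky.mono (ZMod 2) S := by
    funext β; rw [Finset.sum_apply]; simp only [Smolensky.mono_apply]; exact hind j β
  rw [this]; exact Submodule.sum_mem _ fun S hS => Smolensky.mono_mem_lowDeg (hF j S hS)

/-- Refutation schema: a perfect strategy in ANF of degree `≤ r` on the bare `C_k` refutes `r ∈ SmallRingLosesDeg k`. -/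
theorem not_smallRingLosesDeg_of_strat {k r : ℕ} (F : Fin k → Finset (Finset (Fin k))) (hF : ∀ j, ∀ S ∈ F j, S.card ≤ r)
    (hind : ∀ j : Fin k, ∀ β : Fin k → Bool, (if strat F β j = true then (1 : ZMod 2) else 0) = ∑ S ∈ F j, (if (∀ i ∈ S, β i = true) then (1 : ZMod 2) else 0))
    (hperf : ∀ β : Fin k → Bool, OddZeros β → Rel β (strat F β)) : ¬ r ∈ SmallRingLosesDeg k := by
  intro h
  obtain ⟨β, hβ, hn⟩ := h (strat F) (strat_mem_lowDeg F hF hind)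
  exact hn (hperf β hβ)

/-- `C_4`, degree 1: `z_2 = x_2`, `z_3 = x_3`, `z_0 = z_1 = 0`. -/
def F4 : Fin 4 → Finset (Finset (Fin 4)) := ![∅, ∅, {{2}}, {{3}}]

/-- `C_6`, degree 2: `z_4 = x_0 + x_1x_2 + x_1x_4 + x_1x_5 + x_2x_4 + x_3x_5`, `z_5 = x_3 + x_1x_2 + x_1x_4 + x_1x_5 + x_2x_5 + x_3x_4 + x_4x_5`, others `0`. -/
def F6 : Fin 6 → Finset (Finset (Fin 6)) :=
  ![∅, ∅, ∅, ∅, {{0}, {1,2}, {1,4}, {1,5}, {2,4}, {3,5}}, {{3}, {1,2}, {1,4}, {1,5}, {2,5}, {3,4}, {4,5}}]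

/-- `C_8`, degree 3 (24 + 24 monomials on outputs 6, 7; others `0`). -/
def F8 : Fin 8 → Finset (Finset (Fin 8)) :=
  ![∅, ∅, ∅, ∅, ∅, ∅,
    {{0}, {2}, {0,1,2}, {0,1,3}, {0,1,5}, {0,1,7}, {0,2,3}, {0,2,4}, {0,2,5}, {0,2,6}, {0,2,7}, {0,3,4}, {0,3,6}, {0,4,6}, {0,5,6}, {1,4,6}, {2,3,4}, {2,3,6},
      {2,4,6}, {2,5,6}, {3,4,6}, {3,5,6}, {4,5,6}, {4,6,7}},
    {{3}, {5}, {0,1,7}, {0,2,7}, {0,3,5}, {0,3,7}, {0,4,5}, {0,5,7}, {1,2,3}, {1,2,5}, {1,2,7}, {1,3,5}, {1,3,7}, {1,4,7}, {1,5,7}, {1,6,7}, {2,3,5}, {2,3,7},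
      {2,4,5}, {2,5,7}, {3,4,5}, {3,5,6}, {3,5,7}, {4,5,6}}]

/-- FanInRoot helper `F4_deg` (lens-1 g6 FanInRoot package; see the module docstring). -/
theorem F4_deg : ∀ j, ∀ S ∈ F4 j, S.card ≤ 1 := by decide
set_option maxRecDepth 100000 in
/-- FanInRoot helper `F6_deg` (lens-1 g6 FanInRoot package; see the module docstring). -/
theorem F6_deg : ∀ j, ∀ S ∈ F6 j, S.card ≤ 2 := by decide
set_option maxRecDepth 100000 in
set_option maxHeartbeats 2000000 in
/-- FanInRoot helper `F8_deg` (lens-1 g6 FanInRoot package; see the module docstring). -/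
theorem F8_deg : ∀ j, ∀ S ∈ F8 j, S.card ≤ 3 := by decide

set_option maxRecDepth 100000 in
/-- FanInRoot helper `F4_ind` (lens-1 g6 FanInRoot package; see the module docstring). -/
theorem F4_ind : ∀ j : Fin 4, ∀ β : Fin 4 → Bool, (if strat F4 β j = true then (1 : ZMod 2) else 0) = ∑ S ∈ F4 j, (if (∀ i ∈ S, β i = true) then (1 : ZMod 2) else 0) := by
  decide
set_option maxRecDepth 100000 in
set_option maxHeartbeats 4000000 in
/-- FanInRoot helper `F6_ind` (lens-1 g6 FanInRoot package; see the module docstring). -/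
theorem F6_ind : ∀ j : Fin 6, ∀ β : Fin 6 → Bool, (if strat F6 β j = true then (1 : ZMod 2) else 0) = ∑ S ∈ F6 j, (if (∀ i ∈ S, β i = true) then (1 : ZMod 2) else 0) := by
  decide
set_option maxRecDepth 100000 in
set_option maxHeartbeats 40000000 in
/-- FanInRoot helper `F8_ind` (lens-1 g6 FanInRoot package; see the module docstring). -/
theorem F8_ind : ∀ j : Fin 8, ∀ β : Fin 8 → Bool, (if strat F8 β j = true then (1 : ZMod 2) else 0) = ∑ S ∈ F8 j, (if (∀ i ∈ S, β i = true) then (1 : ZMod 2) else 0) := by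
  decide

set_option maxRecDepth 100000 in
/-- FanInRoot helper `F4_perfect` (lens-1 g6 FanInRoot package; see the module docstring). -/
theorem F4_perfect : ∀ β : Fin 4 → Bool, OddZeros β → Rel β (strat F4 β) := by unfold OddZeros; decide
set_option maxRecDepth 100000 in
set_option maxHeartbeats 4000000 in
/-- FanInRoot helper `F6_perfect` (lens-1 g6 FanInRoot package; see the module docstring). -/
theorem F6_perfect : ∀ β : Fin 6 → Bool, OddZeros β → Rel β (strat F6 β) := by unfold OddZeros; decide
set_option maxRecDepth 100000 in
set_option maxHeartbeats 40000000 in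
/-- FanInRoot helper `F8_perfect` (lens-1 g6 FanInRoot package; see the module docstring). -/
theorem F8_perfect : ∀ β : Fin 8 → Bool, OddZeros β → Rel β (strat F8 β) := by unfold OddZeros; decide

end Tight

/-- **TIGHTNESS `r = 1`: `¬ 1 ∈ SmallRingLosesDeg 4`** — single-bit readers are PERFECT on the bare `C_4` (`z_2 = x_2`, `z_3 = x_3`). -/
theorem not_smallRingLosesDeg_4_1 : ¬ 1 ∈ SmallRingLosesDeg 4 :=
  Tight.not_smallRingLosesDeg_of_strat Tight.F4 Tight.F4_deg Tight.F4_ind Tight.F4_perfect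

/-- **TIGHTNESS `r = 2`: `¬ 2 ∈ SmallRingLosesDeg 6`** — degree-2 readers are PERFECT on the bare `C_6`. -/
theorem not_smallRingLosesDeg_6_2 : ¬ 2 ∈ SmallRingLosesDeg 6 :=
  Tight.not_smallRingLosesDeg_of_strat Tight.F6 Tight.F6_deg Tight.F6_ind Tight.F6_perfect

/-- **TIGHTNESS `r = 3`: `¬ 3 ∈ SmallRingLosesDeg 8`** — degree-3 readers are PERFECT on the bare `C_8`. -/
theorem not_smallRingLosesDeg_8_3 : ¬ 3 ∈ SmallRingLosesDeg 8 :=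
  Tight.not_smallRingLosesDeg_of_strat Tight.F8 Tight.F8_deg Tight.F8_ind Tight.F8_perfect

end Summit.QuantumAdvantage.QuantumAdvantage.Theorems.FanInRoot
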